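import Summits.RiemannHypothesis.RiemannHypothesis.Theorems.MotivicDoorDecreeDiagonalClass
import HarnessLib

/-!
# The decreed distribution `N` has order exactly one, at the single point `u = 1`

Connes–Consani motivic door, cc-3 gen 17 (RH-free; no zeros of `ζ`, no primes: the window
`(1, 2)`).  Framing: lottery ticket at the motivic door; RH probability negligible; consolation
prizes are real: a new semi-local Weil-positivity theorem, or a located gap in the Connes–Consani
programme, plus the ff-door theorem.  VERDICT (standing): `Nonempty ArithmeticWeilSurface` is a
restatement of RH in structure clothing, not a different-looking hypothesis.

PRINTED (Connes, Essay, arXiv:1509.05576): p. 14 l. 26–27 "as `N(1)` represents the Euler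
characteristic one should expect that `N(1) = −∞`"; p. 14 l. 58 "the distribution `N(u)` is
positive on `(1, ∞)`"; p. 15 l. 36–39 "`J(u)` … tends to `−∞` when `u → 1⁺` while its value
`J(1)` is finite … `N` is finite as a distribution"; p. 15 l. 44–47 "`N(1) ∼ −½ E log E`";
p. 15 l. 51–53 "`κ(u)` … does not fulfill the natural inequality `N(q) ≤ N(q^r)` … due to the
terms `|1 − u|^{-1}`".  Also Connes–Consani arXiv:1805.10501 §3.1; Bombieri 2000, Thm 2.

PROVED here (additive side `u = e^t`, `N = ccN` on `toMul κ`; order `≤ 1` on all tests is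
`abs_two_mul_ccN_toMul_le`):
* `two_mul_weilArchDensity_eq`, `abs_weilArchDensity_sub_inv_le`: the density
  `w = e^{t/2}/(2 sinh t)` of `N` on `(1, ∞)` is `1/(2t) − k_r/2`, `|w − 1/(2t)| ≤ ¼`;
* `weilArchDensity_mul_lt`: `w(rt) < w(t)` for `r > 1` — the printed failure of
  `N(q) ≤ N(q^r)` for the archimedean part holds at every `q > 1`;
* `abs_integral_weilArchDensity_sub_half_log_le`: `|∫_α^β w − ½ log(β/α)| ≤ (β − α)/4`;
  `half_log_sub_le_ccN_toMul`, `ccN_toMul_le_half_log_add`: two-sided plateau bounds;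
* `abs_ccN_toMul_le_of_eq_zero_near_zero`: `N` has ORDER ZERO off `u = 1`;
* `exists_ccN_toMul_ge`, `not_exists_abs_ccN_toMul_le_mul_iSup`: the positive measure
  `N|_{(1,2)}` has infinite mass at `1⁺` (the printed `N(1) = −∞` is its order-one compensation,
  `two_mul_ccN_toMul_eq_markov`); `N` is NOT of order zero near `u = 1`: order exactly one;
* `exists_abs_ccN_toMul_sub_half_log_le`: `|N(κ_δ) − ½ log(1/δ)| ≤ 3` — the sharp `½`.
-/

noncomputable section

set_option linter.dupNamespace false

open Complex Set MeasureTheory Filter Topology Literature.NumberTheory.LFunctions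
open Literature.NumberTheory.ConnesConsani2019
open Summit.RiemannHypothesis.RiemannHypothesis.Theorems.MotivicDoor.ArchLogLaplacian
open scoped Real ComplexConjugate ArithmeticFunction.vonMangoldt

namespace Summit.RiemannHypothesis.RiemannHypothesis.Theorems.MotivicDoor.ConnesConsani

variable {κ : ℝ → ℝ}

/-! ## 1. The archimedean density against its singular part `1/(2t)` -/

/-- `2 w(t) = 1/t − k_r(t)`: the density of `N` on the additive side is one half of Bombieri's
weight, whose singular part is `1/t` (`archResidualKernel`).  PROVED (definitional). -/
theorem two_mul_weilArchDensity_eq (t : ℝ) :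
    2 * weilArchDensity t = 1 / t - archResidualKernel t := by
  simp only [weilArchDensity, archResidualKernel]
  ring

/-- **`|w(t) − 1/(2t)| ≤ ¼`** for `t > 0` (`|k_r| ≤ ½`, `MotivicDoorArchResidualKernelSharp`).
PROVED. -/
theorem abs_weilArchDensity_sub_inv_le {t : ℝ} (ht : 0 < t) :
    |weilArchDensity t - 1 / (2 * t)| ≤ 1 / 4 := by
  have h := two_mul_weilArchDensity_eq t
  have hk := abs_archResidualKernel_le_half ht
  have e : weilArchDensity t - 1 / (2 * t) = -(archResidualKernel t / 2) := by
    have h2 : (1 : ℝ) / (2 * t) = 1 / t / 2 := by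
      rw [div_div, mul_comm]
    rw [h2]
    linarith
  rw [e, abs_neg, abs_div, abs_two]
  linarith

/-- `w(t) = (e^{t/2} − e^{−3t/2})⁻¹` (all `t`).  PROVED. -/
theorem weilArchDensity_eq_inv (t : ℝ) :
    weilArchDensity t = (Real.exp (t / 2) - Real.exp (-(3 * t / 2)))⁻¹ := by
  have e1 : Real.exp t = Real.exp (t / 2) * Real.exp (t / 2) := by
    rw [← Real.exp_add]; ring_nf
  have e2 : Real.exp (-t) = Real.exp (t / 2) * Real.exp (-(3 * t / 2)) := by
    rw [← Real.exp_add]; ring_nf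
  have hpos : 0 < Real.exp (t / 2) := Real.exp_pos _
  simp only [weilArchDensity, Real.sinh_eq, e1, e2]
  rw [← mul_sub, show 2 * (Real.exp (t / 2) * (Real.exp (t / 2) - Real.exp (-(3 * t / 2))) / 2) =
    Real.exp (t / 2) * (Real.exp (t / 2) - Real.exp (-(3 * t / 2))) by ring]
  rw [div_mul_eq_div_div, div_self hpos.ne', one_div]

/-- **The archimedean density is strictly decreasing on `(0, ∞)`.**  Reading (Connes,
arXiv:1509.05576 p. 15): the archimedean contribution `κ(u)` to the counting distribution `N(u)`
"does not fulfill the natural inequality `N(q) ≤ N(q^r)` expected of a counting function".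
PROVED. -/
theorem strictAntiOn_weilArchDensity : StrictAntiOn weilArchDensity (Ioi 0) := by
  intro s hs t ht hst
  have hs0 : (0 : ℝ) < s := hs
  rw [weilArchDensity_eq_inv, weilArchDensity_eq_inv]
  have hgs : 0 < Real.exp (s / 2) - Real.exp (-(3 * s / 2)) := by
    have : Real.exp (-(3 * s / 2)) < Real.exp (s / 2) := Real.exp_lt_exp.2 (by linarith)
    linarith
  have hlt : Real.exp (s / 2) - Real.exp (-(3 * s / 2)) <
      Real.exp (t / 2) - Real.exp (-(3 * t / 2)) := by
    have h1 : Real.exp (s / 2) < Real.exp (t / 2) := Real.exp_lt_exp.2 (by linarith)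
    have h2 : Real.exp (-(3 * t / 2)) < Real.exp (-(3 * s / 2)) := Real.exp_lt_exp.2 (by linarith)
    linarith
  exact inv_strictAnti₀ hgs hlt

/-- `w(rt) < w(t)` for `t > 0`, `r > 1`: on the multiplicative line, `κ(q^r) < κ(q)`.  PROVED. -/
theorem weilArchDensity_mul_lt {t r : ℝ} (ht : 0 < t) (hr : 1 < r) :
    weilArchDensity (r * t) < weilArchDensity t :=
  strictAntiOn_weilArchDensity (mem_Ioi.2 ht) (mem_Ioi.2 (by nlinarith))
    (by nlinarith)

/-- `w` is continuous on `(0, ∞)`.  PROVED. -/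
private theorem oo_continuousOn_weilArchDensity : ContinuousOn weilArchDensity (Ioi 0) := by
  refine ContinuousOn.div (by fun_prop) (by fun_prop) fun t ht ↦ ?_
  exact (mul_pos two_pos (Real.sinh_pos_iff.2 (mem_Ioi.1 ht))).ne'

/-- **`½ log(β/α) − (β − α)/4 ≤ ∫_α^β w ≤ ½ log(β/α) + (β − α)/4`** for `0 < α ≤ β`.  PROVED. -/
theorem abs_integral_weilArchDensity_sub_half_log_le {α β : ℝ} (hα : 0 < α) (hαβ : α ≤ β) :
    |(∫ t in α..β, weilArchDensity t) - 1 / 2 * Real.log (β / α)| ≤ (β - α) / 4 := by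
  have h0 : (0 : ℝ) ∉ uIcc α β := by
    rw [uIcc_of_le hαβ]; exact fun h ↦ (lt_irrefl _ (hα.trans_le h.1))
  have hinv : ∫ t in α..β, 1 / (2 * t) = 1 / 2 * Real.log (β / α) := by
    rw [← integral_inv h0, ← intervalIntegral.integral_const_mul]
    exact intervalIntegral.integral_congr fun t _ ↦ by ring
  have hwi : IntervalIntegrable weilArchDensity volume α β :=
    (oo_continuousOn_weilArchDensity.mono fun t ht ↦
      mem_Ioi.2 (hα.trans_le (by rw [uIcc_of_le hαβ] at ht; exact ht.1))).intervalIntegrable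
  have hii : IntervalIntegrable (fun t : ℝ ↦ 1 / (2 * t)) volume α β := by
    refine (ContinuousOn.div continuousOn_const (by fun_prop) fun t ht ↦ ?_).intervalIntegrable
    rw [uIcc_of_le hαβ] at ht
    exact (mul_pos two_pos (hα.trans_le ht.1)).ne'
  rw [← hinv, ← intervalIntegral.integral_sub hwi hii]
  have h := intervalIntegral.norm_integral_le_of_norm_le_const (a := α) (b := β) (C := 1 / 4)
    (f := fun t ↦ weilArchDensity t - 1 / (2 * t)) fun t ht ↦ by
      rw [uIoc_of_le hαβ] at ht
      rw [Real.norm_eq_abs]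
      exact abs_weilArchDensity_sub_inv_le (hα.trans ht.1)
  rw [Real.norm_eq_abs, abs_of_nonneg (sub_nonneg.2 hαβ)] at h
  linarith

/-! ## 2. `N` on the window `(1, 2)`: the positive measure `w(t) dt`, two-sided against `½ dt/t` -/

/-- On tests vanishing off `(0, log 2)`: `N(toMul κ) = ∫₀^∞ w(t) κ(t) dt` (no prime power has
`log n < log 2`, and `κ(0) = 0` kills the order-one part).  PROVED. -/
theorem ccN_toMul_eq_setIntegral_weilArchDensity_mul (κ : ℝ → ℝ) (h0 : ∀ t ≤ 0, κ t = 0)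
    (h2 : ∀ t, Real.log 2 ≤ t → κ t = 0) :
    ccN (toMul κ) = ∫ t in Ioi (0 : ℝ), weilArchDensity t * κ t := by
  rw [ccN_toMul_eq_setIntegral κ h0 h2]
  exact setIntegral_congr_fun measurableSet_Ioi fun t _ ↦ by
    simp only [weilArchDensity]
    ring

/-- Integrability of `w κ` on `(0, ∞)` for a Weil test with `κ(0) = 0`.  PROVED. -/
theorem integrableOn_weilArchDensity_mul (hκ : IsWeilTest fun t ↦ (κ t : ℂ)) (hκ0 : κ 0 = 0) :
    IntegrableOn (fun t ↦ weilArchDensity t * κ t) (Ioi 0) := by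
  refine (integrableOn_ccWindowIntegrand κ hκ hκ0).congr_fun (fun t _ ↦ ?_) measurableSet_Ioi
  simp only [weilArchDensity]
  ring

/-- **Lower bound through a plateau.**  If `κ ≥ 0` is a real Weil test vanishing off `(0, log 2)`
and `κ = 1` on `[α, β]`, `0 < α ≤ β`, then `N(toMul κ) ≥ ½ log(β/α) − (β − α)/4`.  PROVED. -/
theorem half_log_sub_le_ccN_toMul (hκ : IsWeilTest fun t ↦ (κ t : ℂ)) (hnn : ∀ t, 0 ≤ κ t)
    (h0 : ∀ t ≤ 0, κ t = 0) (h2 : ∀ t, Real.log 2 ≤ t → κ t = 0) {α β : ℝ} (hα : 0 < α)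
    (hαβ : α ≤ β) (h1 : ∀ t ∈ Icc α β, κ t = 1) :
    1 / 2 * Real.log (β / α) - (β - α) / 4 ≤ ccN (toMul κ) := by
  rw [ccN_toMul_eq_setIntegral_weilArchDensity_mul κ h0 h2]
  have hint := integrableOn_weilArchDensity_mul hκ (h0 0 le_rfl)
  have hmono : ∫ t in Icc α β, weilArchDensity t * κ t ≤
      ∫ t in Ioi (0 : ℝ), weilArchDensity t * κ t :=
    setIntegral_mono_set hint
      ((ae_restrict_iff' measurableSet_Ioi).2 (Eventually.of_forall fun t ht ↦
        mul_nonneg (weilArchDensity_pos ht).le (hnn t)))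
      (Eventually.of_forall fun t (ht : t ∈ Icc α β) ↦ mem_Ioi.2 (hα.trans_le ht.1))
  have heq : ∫ t in Icc α β, weilArchDensity t * κ t = ∫ t in α..β, weilArchDensity t := by
    rw [intervalIntegral.integral_of_le hαβ, integral_Icc_eq_integral_Ioc]
    exact setIntegral_congr_fun measurableSet_Ioc fun t ht ↦ by
      rw [h1 t ⟨ht.1.le, ht.2⟩, mul_one]
  have hlow := abs_integral_weilArchDensity_sub_half_log_le hα hαβ
  rw [abs_le] at hlow
  linarith

/-- **Upper bound through the support.**  If `κ ≤ 1` is a real Weil test vanishing off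
`(α, β)`, `0 < α ≤ β ≤ log 2`, then `N(toMul κ) ≤ ½ log(β/α) + (β − α)/4`.  PROVED. -/
theorem ccN_toMul_le_half_log_add (hκ : IsWeilTest fun t ↦ (κ t : ℂ)) (hle : ∀ t, κ t ≤ 1)
    {α β : ℝ} (hα : 0 < α) (hαβ : α ≤ β) (hβ : β ≤ Real.log 2) (hκα : ∀ t ≤ α, κ t = 0)
    (hκβ : ∀ t, β ≤ t → κ t = 0) :
    ccN (toMul κ) ≤ 1 / 2 * Real.log (β / α) + (β - α) / 4 := by
  have h0 : ∀ t ≤ 0, κ t = 0 := fun t ht ↦ hκα t (ht.trans hα.le)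
  have h2 : ∀ t, Real.log 2 ≤ t → κ t = 0 := fun t ht ↦ hκβ t (hβ.trans ht)
  rw [ccN_toMul_eq_setIntegral_weilArchDensity_mul κ h0 h2]
  have hint := integrableOn_weilArchDensity_mul hκ (h0 0 le_rfl)
  have heq : ∫ t in Ioi (0 : ℝ), weilArchDensity t * κ t =
      ∫ t in Ioc α β, weilArchDensity t * κ t := by
    refine setIntegral_eq_of_subset_of_forall_sdiff_eq_zero measurableSet_Ioi
      (fun t ht ↦ mem_Ioi.2 (hα.trans ht.1)) fun t ht ↦ ?_
    obtain ⟨ht0, ht⟩ := ht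
    rw [mem_Ioc, not_and_or, not_lt, not_le] at ht
    rcases ht with ht | ht
    · rw [hκα t ht, mul_zero]
    · rw [hκβ t ht.le, mul_zero]
  have hwi : IntegrableOn weilArchDensity (Ioc α β) :=
    (oo_continuousOn_weilArchDensity.mono fun t ht ↦ mem_Ioi.2 (hα.trans_le ht.1)
      : ContinuousOn weilArchDensity (Icc α β)).integrableOn_compact isCompact_Icc
      |>.mono_set Ioc_subset_Icc_self
  have hmono : ∫ t in Ioc α β, weilArchDensity t * κ t ≤ ∫ t in Ioc α β, weilArchDensity t :=
    setIntegral_mono_on (hint.mono_set fun t ht ↦ mem_Ioi.2 (hα.trans ht.1)) hwi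
      measurableSet_Ioc fun t ht ↦ by
        have hw := (weilArchDensity_pos (hα.trans ht.1)).le
        calc weilArchDensity t * κ t ≤ weilArchDensity t * 1 :=
            mul_le_mul_of_nonneg_left (hle t) hw
          _ = weilArchDensity t := mul_one _
  have hup := abs_integral_weilArchDensity_sub_half_log_le hα hαβ
  rw [intervalIntegral.integral_of_le hαβ, abs_le] at hup
  linarith

/-! ## 3. Order zero off `u = 1` -/

/-- **Order zero away from the point `u = 1`.**  A real Weil test vanishing on `[0, δ]` (`δ > 0`)
and on `[2a, ∞)` with `|κ| ≤ M₀` has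
`|N(toMul κ)| ≤ (Σ_{log n < 2a} Λ(n) n^{-1/2} + ∫_δ^∞ w(t) dt) · M₀`: off `u = 1` the distribution
`N` is a positive Radon measure (Dirac masses `Λ(n) n^{-1/2}` at `u = n`, density `w`).  PROVED. -/
theorem abs_ccN_toMul_le_of_eq_zero_near_zero (hκ : IsWeilTest fun t ↦ (κ t : ℂ)) {a δ M₀ : ℝ}
    (hδ : 0 < δ) (hκδ : ∀ t ∈ Icc 0 δ, κ t = 0) (hκa : ∀ t, 2 * a ≤ t → κ t = 0)
    (hM₀ : ∀ t, |κ t| ≤ M₀) :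
    |ccN (toMul κ)| ≤ ((∑ n ∈ weilPrimeIndex a, (Λ n : ℝ) / Real.sqrt n) +
        ∫ t in Ioi δ, weilArchDensity t) * M₀ := by
  have hM₀nn : 0 ≤ M₀ := (abs_nonneg _).trans (hM₀ 0)
  have hκ0 : κ 0 = 0 := hκδ 0 ⟨le_rfl, hδ.le⟩
  have h := two_mul_ccN_toMul_eq_markov hκ hκa
  have hI : ∫ t in Ioi (0 : ℝ), weilArchDensity t * (κ 0 - κ t) =
      -∫ t in Ioi δ, weilArchDensity t * κ t := by
    rw [← integral_neg, setIntegral_eq_of_subset_of_forall_sdiff_eq_zero (s := Ioi δ)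
      measurableSet_Ioi (Ioi_subset_Ioi hδ.le) fun t ht ↦ ?_]
    · exact setIntegral_congr_fun measurableSet_Ioi fun t _ ↦ by rw [hκ0]; ring
    · obtain ⟨ht0, htδ⟩ := ht
      rw [hκδ t ⟨le_of_lt ht0, not_lt.1 htδ⟩, hκ0, sub_self, mul_zero]
  have hS : ∑ n ∈ weilPrimeIndex a, (Λ n : ℝ) / Real.sqrt n * (κ 0 - κ (Real.log n)) =
      -∑ n ∈ weilPrimeIndex a, (Λ n : ℝ) / Real.sqrt n * κ (Real.log n) := by
    rw [← Finset.sum_neg_distrib]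
    exact Finset.sum_congr rfl fun n _ ↦ by rw [hκ0]; ring
  rw [hI, hS, hκ0, mul_zero] at h
  have hN : ccN (toMul κ) = (∑ n ∈ weilPrimeIndex a, (Λ n : ℝ) / Real.sqrt n * κ (Real.log n)) +
      ∫ t in Ioi δ, weilArchDensity t * κ t := by linarith
  rw [hN]
  have hP : |∑ n ∈ weilPrimeIndex a, (Λ n : ℝ) / Real.sqrt n * κ (Real.log n)| ≤
      (∑ n ∈ weilPrimeIndex a, (Λ n : ℝ) / Real.sqrt n) * M₀ := by
    rw [Finset.sum_mul]
    refine (Finset.abs_sum_le_sum_abs _ _).trans (Finset.sum_le_sum fun n _ ↦ ?_)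
    have hc : 0 ≤ (Λ n : ℝ) / Real.sqrt n :=
      div_nonneg ArithmeticFunction.vonMangoldt_nonneg (Real.sqrt_nonneg _)
    rw [abs_mul, abs_of_nonneg hc]
    exact mul_le_mul_of_nonneg_left (hM₀ _) hc
  have hA : |∫ t in Ioi δ, weilArchDensity t * κ t| ≤ (∫ t in Ioi δ, weilArchDensity t) * M₀ := by
    rw [← integral_mul_const]
    have h := norm_integral_le_of_norm_le (μ := volume.restrict (Ioi δ))
      (f := fun t ↦ weilArchDensity t * κ t) (g := fun t ↦ weilArchDensity t * M₀)
      ((integrableOn_weilArchDensity_Ioi hδ).mul_const _)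
      ((ae_restrict_iff' measurableSet_Ioi).2 (Eventually.of_forall fun t (ht : δ < t) ↦ by
        rw [Real.norm_eq_abs, abs_mul, abs_of_pos (weilArchDensity_pos (hδ.trans ht))]
        exact mul_le_mul_of_nonneg_left (hM₀ t) (weilArchDensity_pos (hδ.trans ht)).le))
    rw [Real.norm_eq_abs] at h
    exact h
  calc |(∑ n ∈ weilPrimeIndex a, (Λ n : ℝ) / Real.sqrt n * κ (Real.log n)) +
        ∫ t in Ioi δ, weilArchDensity t * κ t|
      ≤ |∑ n ∈ weilPrimeIndex a, (Λ n : ℝ) / Real.sqrt n * κ (Real.log n)| +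
        |∫ t in Ioi δ, weilArchDensity t * κ t| := abs_add_le _ _
    _ ≤ _ := by rw [add_mul]; exact add_le_add hP hA

/-! ## 4. Infinite mass at `u = 1⁺`: `N(1) = −∞`, `N` is not of order zero -/

/-- The plateau bump at scale `δ`: a real Weil test `0 ≤ κ ≤ 1`, `κ = 1` on `[δ, δ + (log 2)/4]`,
`κ = 0` off `(δ/2, 3δ/2 + (log 2)/4)`.  PROVED (`ContDiffBump`). -/
theorem exists_weilTest_plateau {δ : ℝ} (hδ : 0 < δ) :
    ∃ κ : ℝ → ℝ, IsWeilTest (fun t ↦ (κ t : ℂ)) ∧ (∀ t, 0 ≤ κ t ∧ κ t ≤ 1) ∧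
      (∀ t ≤ δ / 2, κ t = 0) ∧ (∀ t, 3 * δ / 2 + Real.log 2 / 4 ≤ t → κ t = 0) ∧
      ∀ t ∈ Icc δ (δ + Real.log 2 / 4), κ t = 1 := by
  have hL : 0 < Real.log 2 := Real.log_pos one_lt_two
  set L := Real.log 2 with hLdef
  let b : ContDiffBump (δ + L / 8) := ⟨L / 8, L / 8 + δ / 2, by positivity, by linarith⟩
  refine ⟨b, ⟨Complex.ofRealCLM.contDiff.comp b.contDiff,
    b.hasCompactSupport.comp_left Complex.ofReal_zero⟩, fun t ↦ ⟨b.nonneg, b.le_one⟩,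
    fun t ht ↦ b.zero_of_le_dist ?_, fun t ht ↦ b.zero_of_le_dist ?_,
    fun t ht ↦ b.one_of_mem_closedBall ?_⟩
  · show L / 8 + δ / 2 ≤ dist t (δ + L / 8)
    rw [Real.dist_eq, abs_of_nonpos (by linarith)]
    linarith
  · show L / 8 + δ / 2 ≤ dist t (δ + L / 8)
    rw [Real.dist_eq, abs_of_nonneg (by linarith)]
    linarith
  · rw [Metric.mem_closedBall, Real.dist_eq, abs_le]
    show -(L / 8) ≤ t - (δ + L / 8) ∧ t - (δ + L / 8) ≤ L / 8
    constructor <;> linarith [ht.1, ht.2]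

/-- `N` through the plateau bump at scale `δ ≤ (log 2)/4` is at least `½ log((log 2)/(4δ)) − ¼`.
PROVED. -/
theorem exists_ccN_toMul_ge_half_log {δ : ℝ} (hδ : 0 < δ) (hδL : δ ≤ Real.log 2 / 4) :
    ∃ κ : ℝ → ℝ, IsWeilTest (fun t ↦ (κ t : ℂ)) ∧ (∀ t, 0 ≤ κ t ∧ κ t ≤ 1) ∧
      (∀ t ∉ Ioo 0 (Real.log 2), κ t = 0) ∧
      1 / 2 * Real.log (Real.log 2 / 4 / δ) - 1 / 4 ≤ ccN (toMul κ) := by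
  have hL : 0 < Real.log 2 := Real.log_pos one_lt_two
  have hL1 : Real.log 2 < 1 := by linarith [Real.log_two_lt_d9]
  obtain ⟨κ, hκ, h01, hlo, hhi, h1⟩ := exists_weilTest_plateau hδ
  have h0 : ∀ t ≤ 0, κ t = 0 := fun t ht ↦ hlo t (by linarith)
  have h2 : ∀ t, Real.log 2 ≤ t → κ t = 0 := fun t ht ↦ hhi t (by linarith)
  refine ⟨κ, hκ, h01, fun t ht ↦ ?_, ?_⟩
  · rw [mem_Ioo, not_and_or, not_lt, not_lt] at ht
    exact ht.elim (h0 t) (h2 t)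
  · have hle := half_log_sub_le_ccN_toMul hκ (fun t ↦ (h01 t).1) h0 h2 hδ (by linarith) h1
    have hlog : Real.log (Real.log 2 / 4 / δ) ≤ Real.log ((δ + Real.log 2 / 4) / δ) :=
      Real.log_le_log (by positivity) (by gcongr; linarith)
    linarith

/-- **`N(1) = −∞` (Essay p. 14): infinite mass of `N` at `u = 1⁺`.**  For every `C` there is a
real Weil test `κ`, `0 ≤ κ ≤ 1`, vanishing off `(0, log 2)` (so `toMul κ` sees no prime and no
pole term), with `N(toMul κ) ≥ C`.  PROVED. -/
theorem exists_ccN_toMul_ge (C : ℝ) :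
    ∃ κ : ℝ → ℝ, IsWeilTest (fun t ↦ (κ t : ℂ)) ∧ (∀ t, 0 ≤ κ t ∧ κ t ≤ 1) ∧
      (∀ t ∉ Ioo 0 (Real.log 2), κ t = 0) ∧ C ≤ ccN (toMul κ) := by
  have hL : 0 < Real.log 2 := Real.log_pos one_lt_two
  set δ := Real.log 2 / 4 * Real.exp (-(2 * max C 0 + 1)) with hδdef
  have hδ : 0 < δ := by positivity
  have hE : Real.exp (-(2 * max C 0 + 1)) ≤ 1 :=
    Real.exp_le_one_iff.2 (by linarith [le_max_right C 0])
  have hδL : δ ≤ Real.log 2 / 4 := by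
    calc δ ≤ Real.log 2 / 4 * 1 := mul_le_mul_of_nonneg_left hE (by positivity)
      _ = _ := mul_one _
  obtain ⟨κ, hκ, h01, hs, hN⟩ := exists_ccN_toMul_ge_half_log hδ hδL
  refine ⟨κ, hκ, h01, hs, ?_⟩
  have hq : Real.log 2 / 4 / δ = Real.exp (2 * max C 0 + 1) := by
    rw [hδdef, Real.exp_neg]
    field_simp
  rw [hq, Real.log_exp] at hN
  linarith [le_max_left C 0]

/-- **`N` is not of order zero at `u = 1` (Essay p. 15: "`J(u) → −∞` when `u → 1⁺` while
`J(1)` is finite").**  No constant `C` bounds `|N(toMul κ)|` by `C · sup |κ|` over the real Weil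
tests vanishing off `(0, log 2)` — although off `u = 1` it is a positive measure
(`abs_ccN_toMul_le_of_eq_zero_near_zero`) and on all tests it has order one
(`abs_two_mul_ccN_toMul_le`).  PROVED. -/
theorem not_exists_abs_ccN_toMul_le_mul_iSup :
    ¬ ∃ C : ℝ, ∀ κ : ℝ → ℝ, IsWeilTest (fun t ↦ (κ t : ℂ)) →
      (∀ t ∉ Ioo 0 (Real.log 2), κ t = 0) → |ccN (toMul κ)| ≤ C * ⨆ t, |κ t| := by
  rintro ⟨C, hC⟩
  obtain ⟨κ, hκ, h01, hs, hN⟩ := exists_ccN_toMul_ge (|C| + 1)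
  have hS0 : 0 ≤ ⨆ t, |κ t| := Real.iSup_nonneg fun t ↦ abs_nonneg _
  have hS1 : ⨆ t, |κ t| ≤ 1 := ciSup_le fun t ↦ by
    rw [abs_of_nonneg (h01 t).1]
    exact (h01 t).2
  have h := hC κ hκ hs
  have h1 : C * ⨆ t, |κ t| ≤ |C| * 1 :=
    (mul_le_mul_of_nonneg_right (le_abs_self C) hS0).trans
      (mul_le_mul_of_nonneg_left hS1 (abs_nonneg C))
  linarith [le_abs_self (ccN (toMul κ))]

/-! ## 5. The sharp coefficient `½ log(1/(u − 1))` -/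

/-- **The sharp coefficient `½`.**  For `0 < δ ≤ (log 2)/4` the plateau bump `κ_δ`
(`= 1` on `[δ, δ + (log 2)/4]`, `= 0` off `(δ/2, 3δ/2 + (log 2)/4)`) has
`|N(toMul κ_δ) − ½ log(1/δ)| ≤ 3`: the mass of `N` on `(u, 2)` diverges like `½ log(1/(u − 1))`
as `u → 1⁺` — the same `½` as in the `−½ E log E` law of the Dirac approximants (Essay p. 15,
`MotivicDoorDecreeDiagonalClass`).  PROVED. -/
theorem exists_abs_ccN_toMul_sub_half_log_le {δ : ℝ} (hδ : 0 < δ) (hδL : δ ≤ Real.log 2 / 4) :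
    ∃ κ : ℝ → ℝ, IsWeilTest (fun t ↦ (κ t : ℂ)) ∧ (∀ t, 0 ≤ κ t ∧ κ t ≤ 1) ∧
      (∀ t ≤ δ / 2, κ t = 0) ∧ (∀ t, 3 * δ / 2 + Real.log 2 / 4 ≤ t → κ t = 0) ∧
      (∀ t ∈ Icc δ (δ + Real.log 2 / 4), κ t = 1) ∧
      |ccN (toMul κ) - 1 / 2 * Real.log (1 / δ)| ≤ 3 := by
  have hL2 : (2 / 3 : ℝ) < Real.log 2 := by linarith [Real.log_two_gt_d9]
  have hL1 : Real.log 2 < 4 / 5 := by linarith [Real.log_two_lt_d9]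
  set L := Real.log 2 with hLdef
  obtain ⟨κ, hκ, h01, hlo, hhi, h1⟩ := exists_weilTest_plateau hδ
  refine ⟨κ, hκ, h01, hlo, hhi, h1, ?_⟩
  have h0 : ∀ t ≤ 0, κ t = 0 := fun t ht ↦ hlo t (by linarith)
  have h2 : ∀ t, Real.log 2 ≤ t → κ t = 0 := fun t ht ↦ hhi t (by linarith)
  have hlow := half_log_sub_le_ccN_toMul hκ (fun t ↦ (h01 t).1) h0 h2 hδ (by linarith) h1
  have hup := ccN_toMul_le_half_log_add hκ (fun t ↦ (h01 t).2) (half_pos hδ)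
    (show δ / 2 ≤ 3 * δ / 2 + L / 4 by linarith) (by linarith) hlo hhi
  have e1 : Real.log ((δ + L / 4) / δ) = Real.log (1 / δ) + Real.log (δ + L / 4) := by
    rw [div_eq_mul_one_div, Real.log_mul (by positivity) (by positivity), add_comm]
  have e2 : Real.log ((3 * δ / 2 + L / 4) / (δ / 2)) =
      Real.log (1 / δ) + Real.log (3 * δ + L / 2) := by
    have e : (3 * δ / 2 + L / 4) / (δ / 2) = (3 * δ + L / 2) * (1 / δ) := by
      field_simp
      ring
    rw [e, Real.log_mul (by positivity) (by positivity), add_comm]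
  have b1 : -5 ≤ Real.log (δ + L / 4) := by
    have hx : 0 < δ + L / 4 := by positivity
    have hi : (δ + L / 4)⁻¹ ≤ (L / 4)⁻¹ := by
      rw [inv_le_inv₀ hx (by positivity)]
      linarith
    have hL4 : (L / 4)⁻¹ ≤ 6 := by
      rw [inv_le_comm₀ (by positivity) (by norm_num)]
      linarith
    linarith [Real.one_sub_inv_le_log_of_pos hx]
  have b2 : Real.log (3 * δ + L / 2) ≤ 0 := Real.log_nonpos (by positivity) (by linarith)
  rw [e1] at hlow
  rw [e2] at hup
  rw [abs_le]
  constructor <;> linarith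

end Summit.RiemannHypothesis.RiemannHypothesis.Theorems.MotivicDoor.ConnesConsani
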